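import Literature.NumberTheory.LFunctions.RieszMeanPerron
import HarnessLib

/-!
# The Riesz mean of order one of a Dirichlet series as a Mellin integral (Perron, absolutely convergent)

Topic `Literature/NumberTheory/LFunctions`; companion of `RieszMeanPerron.lean`, whose
`rieszMean_vonMangoldt_eq_integral_LSeries` is the case `a = Λ` of the present file. Everything
here is PROVED.

For any coefficients `a : ℕ → ℂ` whose Dirichlet series `L(a, s) = Σ a(n) n^{-s}` converges
absolutely on the line `Re s = σ > 0`, and any `x > 0`,

  `Σ_{n ≤ x} a(n) (x - n) = (1/2π) ∫_{-∞}^{∞} x^{1+σ+it} L(a, σ+it) dt/((σ+it)(σ+1+it))`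

(`rieszMeanOne_eq_integral_LSeries`; complex coefficients, no condition at `n = 0` — the case of
real coefficients with `a(0) = 0` is `rieszMean_eq_integral_LSeries` in
`GRHChebyshevPsiLowerBound.lean`, not imported here to keep the number-field machinery out of the
smooth-number files): Perron's formula for the Riesz mean of order one
[MontgomeryVaughan2007, §5.1 (5.19)–(5.20) with `k = 1`], i.e. Ingham's Theorem B of Ch. II §5,
`(1/2πi) ∫_{(σ)} y^s ds/(s(s+1)) = (1 - 1/y)⁺`, summed against the absolutely convergent series.
The kernel is integrable (`integrable_kernel`), so no truncation of the line of integration is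
needed; this is the form in which the saddle-point method for smooth numbers
(Hildebrand–Tenenbaum) is run in the tree (`L(a, s) = ζ(s, y) = Π_{p ≤ y} (1 - p^{-s})⁻¹`, `σ = α(x, y)`).

## References

* H. L. Montgomery, R. C. Vaughan, *Multiplicative Number Theory I*, CUP 2007, §5.1 (5.17)–(5.20).
* A. E. Ingham, *The Distribution of Prime Numbers*, Cambridge Tract 30, Ch. II §5 Theorem B.
-/

noncomputable section

open Complex Filter Set MeasureTheory Real
open scoped Topology LSeries.notation

namespace Literature.NumberTheory.LFunctions

/-- One term: for `x > 0`, `σ > 0`, `n ≥ 1` and any coefficient sequence `a`,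
`a(n) (x - n)⁺ = (1/2π) ∫ x^{1+σ+it} a(n) n^{-(σ+it)} dt/((σ+it)(σ+1+it))`. [folklore] -/
theorem coeff_mul_posPart_eq_integral {x : ℝ} (hx : 0 < x) {σ : ℝ} (hσ : 0 < σ) (a : ℕ → ℂ)
    {n : ℕ} (hn : n ≠ 0) :
    a n * (((max (x - n) 0 : ℝ)) : ℂ) =
      (1 / (2 * π) : ℂ) * ∫ t : ℝ, (x : ℂ) ^ (1 + (σ + t * I)) *
        LSeries.term a (σ + t * I) n * (1 / ((σ + t * I) * (σ + t * I + 1))) := by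
  have hn0 : (0 : ℝ) < n := Nat.cast_pos.2 (Nat.pos_of_ne_zero hn)
  have hy : 0 < (n : ℝ) / x := div_pos hn0 hx
  have hK := mellinInv_kernel_eq hσ hy
  unfold mellinInv at hK
  -- `x · max(1 - n/x, 0) = max(x - n, 0)`
  have hmax : (x : ℝ) * max (1 - n / x) 0 = max (x - n) 0 := by
    rw [mul_max_of_nonneg _ _ hx.le, mul_sub, mul_one, mul_div_cancel₀ _ hx.ne', mul_zero]
  have hlhs : a n * (((max (x - n) 0 : ℝ)) : ℂ) =
      a n * (x : ℂ) * ((max (1 - (n : ℝ) / x) 0 : ℝ) : ℂ) := by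
    rw [← hmax]; push_cast; ring
  rw [hlhs, ← hK, Complex.real_smul]
  have hx0 : (x : ℂ) ≠ 0 := ofReal_ne_zero.2 hx.ne'
  have hnC : (n : ℂ) ≠ 0 := Nat.cast_ne_zero.2 hn
  -- pointwise identity of the integrands
  have hpt : ∀ t : ℝ, a n * (x : ℂ) *
      (((n : ℂ) / (x : ℂ)) ^ (-((σ : ℂ) + t * I)) •
        (1 / (((σ : ℂ) + t * I) * ((σ : ℂ) + t * I + 1)))) =
      (x : ℂ) ^ (1 + (σ + t * I)) * LSeries.term a (σ + t * I) n *
        (1 / ((σ + t * I) * (σ + t * I + 1))) := by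
    intro t
    set s : ℂ := σ + t * I with hs
    simp only [smul_eq_mul]
    have hpow : ((n : ℂ) / (x : ℂ)) ^ (-s) = (x : ℂ) ^ s / (n : ℂ) ^ s := by
      rw [show (n : ℂ) / (x : ℂ) = (((n : ℝ) * x⁻¹ : ℝ) : ℂ) by push_cast; ring, cpow_neg,
        ofReal_mul, mul_cpow_ofReal_nonneg hn0.le (inv_nonneg.2 hx.le), ofReal_inv,
        inv_cpow _ _ ?_, mul_inv, inv_inv]
      · simp only [ofReal_natCast]; ring
      · rw [arg_ofReal_of_nonneg hx.le]; exact Real.pi_pos.ne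
    rw [hpow, LSeries.term_of_ne_zero hn]
    conv_rhs => rw [cpow_add _ _ hx0, cpow_one]
    field_simp
  calc a n * (x : ℂ) * ((((1 / (2 * π) : ℝ)) : ℂ) *
        ∫ t : ℝ, (((n : ℝ) / x : ℝ) : ℂ) ^ (-((σ : ℂ) + t * I)) •
          (fun s : ℂ ↦ 1 / (s * (s + 1))) ((σ : ℂ) + t * I))
      = (((1 / (2 * π) : ℝ)) : ℂ) * ∫ t : ℝ, a n * (x : ℂ) *
          ((((n : ℝ) / x : ℝ) : ℂ) ^ (-((σ : ℂ) + t * I)) •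
            (fun s : ℂ ↦ 1 / (s * (s + 1))) ((σ : ℂ) + t * I)) := by
        rw [integral_const_mul]; ring
    _ = _ := by
        push_cast
        congr 1
        exact integral_congr_ae (Eventually.of_forall hpt)

/-- The case `a(0) = 0` of `rieszMeanOne_eq_integral_LSeries` (the value `a(0)` is invisible to both
sides, but the bookkeeping is simpler). [cite: MontgomeryVaughan2007, §5.1 (5.19)–(5.20)] -/
theorem rieszMeanOne_eq_integral_LSeries_of_map_zero {x : ℝ} (hx : 0 < x) {σ : ℝ} (hσ : 0 < σ)
    {a : ℕ → ℂ} (ha0 : a 0 = 0) (ha : LSeriesSummable a σ) :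
    ∑ n ∈ Finset.Ioc 0 ⌊x⌋₊, a n * (((x - n : ℝ)) : ℂ) =
      (1 / (2 * π) : ℂ) * ∫ t : ℝ, (x : ℂ) ^ (1 + (σ + t * I)) *
        LSeries a (σ + t * I) * (1 / ((σ + t * I) * (σ + t * I + 1))) := by
  have hx0 : (x : ℂ) ≠ 0 := ofReal_ne_zero.2 hx.ne'
  -- the kernel K, the coefficients G n, the terms F n = G n · K
  set K : ℝ → ℂ := fun t ↦ 1 / (((σ : ℂ) + t * I) * ((σ : ℂ) + t * I + 1)) with hK
  set G : ℕ → ℝ → ℂ := fun n t ↦ (x : ℂ) ^ (1 + (σ + t * I)) *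
    LSeries.term a (σ + t * I) n with hG
  set F : ℕ → ℝ → ℂ := fun n t ↦ G n t * K t with hF
  have hnormG : ∀ n t, ‖G n t‖ = x ^ (1 + σ) * ‖LSeries.term a σ n‖ := by
    intro n t
    simp only [hG, norm_mul]
    congr 1
    · rw [norm_cpow_eq_rpow_re_of_pos hx]; simp
    · rcases eq_or_ne n 0 with rfl | hn
      · simp [LSeries.term_zero]
      · rw [LSeries.norm_term_eq, LSeries.norm_term_eq]
        simp [hn]
  have hcontG : ∀ n, Continuous (G n) := by
    intro n
    simp only [hG]
    refine Continuous.mul ?_ ?_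
    · refine continuous_iff_continuousAt.2 fun t ↦ ?_
      exact (continuousAt_const_cpow hx0).comp (f := fun t : ℝ ↦ 1 + ((σ : ℂ) + t * I))
        (by fun_prop)
    · rcases eq_or_ne n 0 with rfl | hn
      · simp only [LSeries.term_zero]; exact continuous_const
      · simp only [LSeries.term_of_ne_zero hn]
        refine continuous_const.div ?_ fun t ↦ ?_
        · refine continuous_iff_continuousAt.2 fun t ↦ ?_
          exact (continuousAt_const_cpow (Nat.cast_ne_zero.2 hn)).comp
            (f := fun t : ℝ ↦ ((σ : ℂ) + t * I)) (by fun_prop)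
        · exact cpow_ne_zero_iff.2 (Or.inl (Nat.cast_ne_zero.2 hn))
  have hintK : Integrable K := integrable_kernel hσ
  have hintF : ∀ n, Integrable (F n) := fun n ↦
    hintK.bdd_mul (hcontG n).aestronglyMeasurable (Eventually.of_forall fun t ↦ (hnormG n t).le)
  -- summability of the norms
  have hsumF : Summable fun n ↦ ∫ t, ‖F n t‖ := by
    have hS : Summable fun n ↦ ‖LSeries.term a σ n‖ := ha.norm
    have := (hS.mul_left (x ^ (1 + σ))).mul_right (∫ t : ℝ, ‖K t‖)
    refine this.congr fun n ↦ ?_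
    rw [← integral_const_mul]
    refine integral_congr_ae (Eventually.of_forall fun t ↦ ?_)
    simp only [hF, norm_mul, hnormG n t]
  -- left side: sum of the terms
  have hterm : ∀ n : ℕ, a n * (((max (x - n) 0 : ℝ)) : ℂ) = (1 / (2 * π) : ℂ) * ∫ t, F n t := by
    intro n
    rcases eq_or_ne n 0 with rfl | hn
    · simp [hF, hG, LSeries.term_zero, ha0]
    · exact coeff_mul_posPart_eq_integral hx hσ a hn
  have hlhs : ∑ n ∈ Finset.Ioc 0 ⌊x⌋₊, a n * (((x - n : ℝ)) : ℂ) =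
      ∑' n : ℕ, a n * (((max (x - n) 0 : ℝ)) : ℂ) := by
    have h0 : (0 : ℕ) ∉ Finset.Ioc 0 ⌊x⌋₊ := by simp
    rw [tsum_eq_sum (s := insert 0 (Finset.Ioc 0 ⌊x⌋₊)), Finset.sum_insert h0]
    · simp only [ha0, zero_mul, zero_add]
      refine Finset.sum_congr rfl fun n hn ↦ ?_
      rw [Finset.mem_Ioc] at hn
      have hnx : (n : ℝ) ≤ x := (Nat.cast_le.2 hn.2).trans (Nat.floor_le hx.le)
      rw [max_eq_left (by linarith)]
    · intro n hn
      rw [Finset.mem_insert, not_or, Finset.mem_Ioc, not_and_or, not_lt, not_le] at hn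
      obtain ⟨hn0, hn'⟩ := hn
      have hn1 : ⌊x⌋₊ < n := by
        rcases hn' with h | h
        · exact absurd h (not_le.2 (Nat.pos_of_ne_zero hn0))
        · exact h
      have hxn : x < n := by
        have := Nat.lt_of_floor_lt hn1
        exact_mod_cast this
      rw [max_eq_right (by linarith)]
      simp
  rw [hlhs, tsum_congr hterm, tsum_mul_left, integral_tsum_of_summable_integral_norm hintF hsumF]
  congr 1
  refine integral_congr_ae (Eventually.of_forall fun t ↦ ?_)
  simp only [hF, hG, hK]
  rw [LSeries, ← tsum_mul_left, ← tsum_mul_right]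

/-- **The Riesz mean of order one of an absolutely convergent Dirichlet series as a Mellin integral**
(Perron's formula of order one [MontgomeryVaughan2007, §5.1 (5.19)–(5.20), `k = 1`]; Ingham Ch. II
§5 Theorem B): for `x > 0`, `σ > 0` and coefficients `a` with `Σ_{n ≥ 1} |a(n)| n^{-σ} < ∞`,
`Σ_{1 ≤ n ≤ x} a(n)(x - n) = (1/2π) ∫_{-∞}^{∞} x^{1+s} L(a, s)/(s(s+1)) dt`, `s = σ + it`, the
integral converging absolutely. [cite: MontgomeryVaughan2007, §5.1 (5.19)–(5.20)] -/
theorem rieszMeanOne_eq_integral_LSeries {x : ℝ} (hx : 0 < x) {σ : ℝ} (hσ : 0 < σ) {a : ℕ → ℂ}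
    (ha : LSeriesSummable a σ) :
    ∑ n ∈ Finset.Ioc 0 ⌊x⌋₊, a n * (((x - n : ℝ)) : ℂ) =
      (1 / (2 * π) : ℂ) * ∫ t : ℝ, (x : ℂ) ^ (1 + (σ + t * I)) *
        LSeries a (σ + t * I) * (1 / ((σ + t * I) * (σ + t * I + 1))) := by
  -- replace `a` by `a'` with `a'(0) = 0`
  set a' : ℕ → ℂ := fun n ↦ if n = 0 then 0 else a n with ha'
  have hcongr : ∀ {n : ℕ}, n ≠ 0 → a' n = a n := fun {n} hn ↦ by simp [ha', hn]
  have ha'S : LSeriesSummable a' σ := (LSeriesSummable_congr (σ : ℂ) hcongr).2 ha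
  have hL : ∀ t : ℝ, LSeries a' (σ + t * I) = LSeries a (σ + t * I) := fun t ↦
    LSeries_congr hcongr _
  have hsum : ∑ n ∈ Finset.Ioc 0 ⌊x⌋₊, a n * (((x - n : ℝ)) : ℂ) =
      ∑ n ∈ Finset.Ioc 0 ⌊x⌋₊, a' n * (((x - n : ℝ)) : ℂ) := by
    refine Finset.sum_congr rfl fun n hn ↦ ?_
    rw [Finset.mem_Ioc] at hn
    rw [hcongr (Nat.pos_iff_ne_zero.1 hn.1)]
  rw [hsum, rieszMeanOne_eq_integral_LSeries_of_map_zero hx hσ (by simp [ha']) ha'S]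
  simp only [hL]

end Literature.NumberTheory.LFunctions

end
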